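/-
Copyright: the b2b-balaban cell (near-miss cell 7), T⁴-continuum fan-out; row NE7b S4c (carrier debt F-ne7bp1g22-1(c) of
the COUNT route), part 3b, seat `t4-ne7b-formalise-leaf-02`.  Released under the licence of the surrounding project.
-/
import Summits.QuantumFields.BalabanUV.T4Continuum.Support.HistoryTreeShapeLE
import Summits.QuantumFields.BalabanUV.T4Continuum.Support.CountThresholdUniform

/-!
# Row NE7b S4c, part 3b: the COUNT exit over the canonical menus WITHOUT the renewal-at-reach clause, threshold named

Summits-side support leaf of the T⁴-continuum cell (rung (B)+1 on a FINITE torus only; NOT infinite volume, NOT the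
mass gap, NOT the Clay statement; NOT a proof of the spine estimate NE7b).  Row NE7b, route «COUNT», claim-table row
S4c (owner's ruling R-OWNER-22-6 (i): «`relWeightBound_lateMergers_of_irThresholdLE` — same statement as
`CountThresholdExit.relWeightBound_lateMergers_of_irThreshold` with `ConsistentTH … D G′` (at `D = 0`: `ConsistentT`)
replaced by `ConsistentTLE … G′`»).  [folklore] bookkeeping over the lineage's OWN typed carrier; nothing is quoted from
print, nothing printed is asserted, ONE bookkeeping definition (the named threshold `irThresholdTLE`, a real number
depending on the symbolic constants `(C, L, r, β₀)` only — trigger condition c6), no `def … : Prop` fact, no `[cite:]`.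

WHAT.  §1 `irThresholdTLE C L r β₀` := the witness of `T4TaggedShapeBanking.exists_payThreshold` chosen once (`0` off
`ThresholdOK`); `payLE_of_irThreshold` (its specification: the three scale-indexed pay inequalities along every run of
the typed flow with `irThresholdTLE ≤ log g_K⁻²`); **`rawFactorLE_of_irThreshold`** (hence the raw-factor bound for
every `ConsistentTLE`, fresh tagged genealogy at that cutoff — `HistoryTreeShapeLE.rawFactorLE_of_pay`).  §2
**`relWeightBound_canon_of_irThresholdLE`** — THE TH EXIT AT `D = 0` WITHOUT THE RENEWAL-AT-REACH CLAUSE: the statement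
of `CountThresholdExit.relWeightBound_lateMergers_of_irThreshold` with (a) no horizon `D` (so no padded lives, no
merger-padded bank), (b) the labelling binder asking, at each counted branching record, for SOME tagged genealogy `G′`
with `ConsistentTLE sh C K (R K) G′` (renewal at `h + 1 ≤ reach`), `G′.WF (dictWT sh (R K) C.n₁)`, `K < reach G′`,
`relabel (shape ∘ sh) G′ = G` and the price clause `y ≤ Δ·(Λ′^{partnerAges}·e^{−credits}·e^{+lifeCost})`, (c) the
threshold `irThresholdTLE C L r β₀` (independent of `sh`); conclusion `∃ K₁ ≥ K₀, RelWeightBound …` with budget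
`𝟙·Cn·recordsBudget (Δ·birthMass C) C.κ₁ V Λ η̄₊ j⋆`, rates, fixed point, CONDITION `Λ·e^{η̄₊ − κ₁} < 1` UNCHANGED.

HOW THE SOCKET USES IT.  A v3-socket member `(z, G′)` with `ConsistentTLE`, `FreshT`, `Chrono (PEv.step ∘ sh)`, the
caps and `K < reach` supplies `hlabTLE` (well-formedness by `HistoryTreeShapeLE.wf_of_consistentTLE_freshT_chrono`) and
`hstr` (slot membership by `HistoryCanonLE.mem_bliveSlots_of_chronoLE` ∕ `mem_boldSlots_of_chronoLE`); the display
`RenewAtReach` is then unnecessary.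

HONEST.  Re-derivation of OUR exit with one clause of OUR predicate relaxed; nothing of print asserted; NE7b NOT proved;
spine 0/9.  HONEST DEPENDENCY (cell): continuum YM on T⁴ ⇐ BetaPertH ∧ nine spine estimates (0/9 proved); BetaPertH ⇐
(D1) ∧ (D4) ∧ CAP+tail.  This file changes none of it.
-/

open Finset
open Literature.MathematicalPhysics.QuantumFieldTheory.Balaban1983to89
open T4PersistenceDictionary T4PersistentHistoryCount T4BankedInduction T4PrintedShapeBanking
open T4WeightBudget T4GlobalDenominator T4LiveClassFibration T4LiveStructureGas T4LiveGasToTerms T4RecordPriceSeam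
open T4PartnerMultiplicity T4BranchingRecordsGas T4TaggedShapeBanking T4CanonicalMenus T4CountHorizon
open Summit.QuantumFields.BalabanUV.T4Continuum.LateMergers
open Summit.QuantumFields.BalabanUV.T4Continuum.HistoryBankingLE
open Summit.QuantumFields.BalabanUV.T4Continuum.HistoryBankingLEInduction
open Summit.QuantumFields.BalabanUV.T4Continuum.HistoryTreeShapeLE
open Summit.QuantumFields.BalabanUV.T4Continuum.CountThresholdUniform

namespace Summit.QuantumFields.BalabanUV.T4Continuum.HistoryExitLE

noncomputable section

/-! ## §1 The threshold, named; the raw-factor bound along the typed flow -/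

section Threshold

/-- **THE PAY THRESHOLD, NAMED**: the witness of `T4TaggedShapeBanking.exists_payThreshold` chosen once — a function of
the symbolic constants `(C, L, r, β₀)` only (`0` off the side conditions, where it is never used).  Independent of the
shape map and of any horizon. [folklore] -/
def irThresholdTLE (C : T4PrintedShapeBanking.Consts) (L r : ℕ) (β₀ : ℝ) : ℝ :=
  haveI := Classical.dec (ThresholdOK C L r β₀)
  if h : ThresholdOK C L r β₀ then
    Classical.choose (exists_payThreshold C h.valid h.a_pos h.A₀_pos h.one_le_L h.β₀_nonneg h.rq_lt)
  else 0

variable {C : T4PrintedShapeBanking.Consts} {L r : ℕ} {β₀ : ℝ}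

/-- its specification: along every run of the typed flow ((2.7), (2.5), `1 ≤ log g_s⁻²`) with
`irThresholdTLE C L r β₀ ≤ log g_K⁻²` the three scale-indexed pay inequalities (birth, renewal, merger) hold at the
cutoff `K`. [folklore] -/
theorem payLE_of_irThreshold (h : ThresholdOK C L r β₀) (K : ℕ) (R : ℕ → ℕ) (g : ℕ → ℝ) (β' : ℝ)
    (h27 : B14.FlowIneq27 g β' β₀ C.p₀ K) (hR : ∀ s, s ≤ K → B14.IsRj L r (g s) (R s))
    (hx1 : ∀ s, s ≤ K → 1 ≤ Real.log ((g s) ^ 2)⁻¹) (hir : irThresholdTLE C L r β₀ ≤ Real.log ((g K) ^ 2)⁻¹) :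
    (∀ s, s ≤ K → ∀ d' : ℕ,
        (C.Eb + C.μ + (3 * C.E₂ * (L : ℝ) ^ C.q' + C.E₃ * (L : ℝ) ^ C.q' + 3 * C.κ₁) * (R s : ℝ) ^ (C.q' + 1)) *
            ((d' : ℝ) + 1) + 2 * p0Profile C.A₀ C.p₀ (g s) ≤
          C.a * (p0Profile C.A₀ C.p₀ (g s)) ^ 2 * ((d' : ℝ) + 1) + 2 * p0Profile C.A₀ C.p₀ (g s)) ∧
      (∀ h, h + 1 ≤ K →
        2 * C.E₂ * (L : ℝ) ^ C.q' * (R (h + 1) : ℝ) ^ (C.q' + 1) + (C.κ₁ * ((R (h + 1) : ℝ) + 1) + C.E₀) ≤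
          p0Profile C.A₀ C.p₀ (g h)) ∧
      (∀ m s, m ≤ s → s ≤ K →
        ((1 + C.n₁) * C.E₂ * (L : ℝ) ^ C.q' + C.dC * C.E₃ * (L : ℝ) ^ C.q') * (R s : ℝ) ^ (C.q' + 1) +
            (C.κ₁ * ((C.n₁ : ℝ) + R s) + C.E₀) ≤ 2 * p0Profile C.A₀ C.p₀ (g m)) := by
  have hdef : irThresholdTLE C L r β₀ =
      Classical.choose (exists_payThreshold C h.valid h.a_pos h.A₀_pos h.one_le_L h.β₀_nonneg h.rq_lt) := by
    unfold irThresholdTLE; rw [dif_pos h]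
  have hspec := Classical.choose_spec (exists_payThreshold C h.valid h.a_pos h.A₀_pos h.one_le_L h.β₀_nonneg h.rq_lt)
  exact hspec K R g β' h27 hR hx1 (hdef ▸ hir)

variable {ε : Type*} [DecidableEq ε]

/-- **THE RAW-FACTOR BOUND ALONG THE TYPED FLOW AT THE NAMED THRESHOLD**: for every shape map `sh`, along every run
((2.7), (2.9), (2.5), `1 ≤ log g_s⁻²`) with `irThresholdTLE C L r β₀ ≤ log g_K⁻²`, every `ConsistentTLE`, fresh tagged
genealogy obeys `e^{−credits}·e^{+lifeCost} ≤ rho root·e^{−κ₁W root}·∏_{record}(e^{−κ₁W e}·eta e)`. [folklore] -/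
theorem rawFactorLE_of_irThreshold (sh : ε → PEv) (h : ThresholdOK C L r β₀) (K : ℕ) (R : ℕ → ℕ) (g : ℕ → ℝ)
    (β' : ℝ) (h27 : B14.FlowIneq27 g β' β₀ C.p₀ K) (h29 : B14FlowStep.FlowIneq29 R g L β' β₀ K)
    (hR : ∀ s, s ≤ K → B14.IsRj L r (g s) (R s)) (hx1 : ∀ s, s ≤ K → 1 ≤ Real.log ((g s) ^ 2)⁻¹)
    (hir : irThresholdTLE C L r β₀ ≤ Real.log ((g K) ^ 2)⁻¹) :
    ∀ G : Gen ε, ConsistentTLE sh C K R G → FreshT G →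
      Real.exp (-credits (credit C g ∘ sh) G) * Real.exp (lifeCost (dictWT sh R C.n₁) (costT sh C K R) G) ≤
        (rho C g ∘ sh) G.root * Real.exp (-(C.κ₁ * ((dictWT sh R C.n₁ G.root : ℕ) : ℝ))) *
          ∏ e ∈ G.events.erase G.root,
            (Real.exp (-(C.κ₁ * ((dictWT sh R C.n₁ e : ℕ) : ℝ))) * (eta C ∘ sh) e) := by
  obtain ⟨Hb, Hr, Hm⟩ := payLE_of_irThreshold h K R g β' h27 hR hx1 hir
  intro G hc hf
  exact rawFactorLE_of_pay h.valid h29 h.one_le_L (one_le_R hR h.one_le_L) Hb Hr Hm hc hf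

end Threshold

/-! ## §2 The exit over the canonical menus, no renewal-at-reach clause -/

section Exit

variable {ε γ κ ι : Type*} [DecidableEq ε] [DecidableEq γ] [DecidableEq κ] {l₀ : ℝ} {K₀ : ℕ} {π : ℕ → ι → κ}
  {T : ℕ → Finset ι} {A A' : ℕ → ℝ → ι → ℝ} {Bad' : ℕ → ℝ → Finset κ} {dead dead' : ℕ → ℝ → ι → ℝ}
  {F Rf F' Rf' : ℕ → κ → ℝ} {nlow nup mlow mup : ℕ → ℝ → ℝ} {Cn : ℝ}

/-- **THE COUNT EXIT OVER THE CANONICAL MENUS, NO RENEWAL-AT-REACH CLAUSE, THRESHOLD NAMED.**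
`CountThresholdExit.relWeightBound_lateMergers_of_irThreshold` at `D = 0` with the labelling binder over `ConsistentTLE`
(renewal at `h + 1 ≤ reach`) ∧ `Gen.WF`, threshold `irThresholdTLE C L r β₀`; budget `𝟙·Cn·recordsBudget (Δ·birthMass C)
C.κ₁ V Λ η̄₊ j⋆`; every other binder VERBATIM. [folklore] -/
theorem relWeightBound_canon_of_irThresholdLE (sh : ε → PEv) {C : T4PrintedShapeBanking.Consts} {L r : ℕ}
    {β₀ : ℝ} (h : ThresholdOK C L r β₀) (hμ₀ : 0 < C.μ)
    (Cell : ℕ → ℕ → Finset γ) {V Λ : ℝ} (hV : 0 ≤ V) (hΛ : 0 < Λ)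
    (hcell : ∀ K a, ((Cell K a).card : ℝ) ≤ V * Λ ^ a) (Dcap Ncap : ℕ → ℕ)
    (jstar : ℕ → ℕ) (hj : ∀ K, jstar K ≤ K) {c : ℝ} (hc : 0 < c)
    (hfrac : ∀ K : ℕ, c * K ≤ ((K - jstar K : ℕ) : ℝ)) {Δ : ℝ} (hΔ : 1 ≤ Δ)
    (hA : Regeneration l₀ π T A Bad' dead F Rf nlow nup Cn K₀)
    (hA' : Regeneration l₀ π T A' Bad' dead' F' Rf' mlow mup Cn K₀) (hCn : 0 ≤ Cn)
    (R : ℕ → ℕ → ℕ) (g : ℕ → ℕ → ℝ) (β' : ℕ → ℝ)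
    (h27 : ∀ K, K₀ ≤ K → B14.FlowIneq27 (g K) (β' K) β₀ C.p₀ K)
    (h29 : ∀ K, K₀ ≤ K → B14FlowStep.FlowIneq29 (R K) (g K) L (β' K) β₀ K)
    (hR : ∀ K, K₀ ≤ K → ∀ s, s ≤ K → B14.IsRj L r (g K s) (R K s))
    (hx1 : ∀ K, K₀ ≤ K → ∀ s, s ≤ K → 1 ≤ Real.log ((g K s) ^ 2)⁻¹)
    (hir : ∀ K, K₀ ≤ K → irThresholdTLE C L r β₀ ≤ Real.log ((g K K) ^ 2)⁻¹)
    (hP : ∀ K s, 0 ≤ p0Profile C.A₀ C.p₀ (g K s))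
    {ηplus : ℝ} (hηplus : 0 ≤ ηplus) (hr : Λ * Real.exp (ηplus - C.κ₁) < 1)
    {Λ' : ℝ} (hΛ0 : 0 ≤ Λ') (h1 : Λ' * Real.exp (-C.κ₁) * Real.exp ηplus < 1)
    (hx : (Real.exp (-C.E₀) + Real.exp (-C.E₀) * birthMass C *
          (Λ' * Real.exp (-C.κ₁) / (1 - Λ' * Real.exp (-C.κ₁) * Real.exp ηplus))) * Real.exp ηplus ≤
        Real.exp ηplus - 1)
    (y : ℕ → ℕ → γ → Gen PEv → ℝ)
    (hy0 : ∀ K, ∀ j ≤ K, ∀ z ∈ Cell K (K - j), ∀ G ∈ canonFam Dcap Ncap K j, 0 ≤ y K j z G)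
    (hlabTLE : ∀ K, K₀ ≤ K → ∀ j ≤ K, ∀ z ∈ Cell K (K - j), ∀ G ∈ canonFam Dcap Ncap K j,
      y K j z G ≤ 0 ∨ ∃ G' : Gen ε, ConsistentTLE sh C K (R K) G' ∧ G'.WF (dictWT sh (R K) C.n₁) ∧
        K < G'.reach (dictWT sh (R K) C.n₁) ∧ relabel (shape ∘ sh) G' = G ∧
        y K j z G ≤ Δ * (Λ' ^ partnerAges (PEv.step ∘ sh) G' * (Real.exp (-credits (credit C (g K) ∘ sh) G') *
          Real.exp (lifeCost (dictWT sh (R K) C.n₁) (costT sh C K (R K)) G'))))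
    (str : ℕ → κ → Finset (BSlot γ PEv))
    (hinj : ∀ K t, |t| ≤ l₀ → K₀ ≤ K → Set.InjOn (str K) (Bad' K t))
    (hstr : ∀ K t, |t| ≤ l₀ → K₀ ≤ K → ∀ c ∈ Bad' K t,
      str K c ⊆ bliveSlots Cell (canonFam Dcap Ncap) K ∧
        ∃ o ∈ boldSlots Cell (canonFam Dcap Ncap) jstar K, o ∈ str K c)
    (hF : ∀ K t, |t| ≤ l₀ → K₀ ≤ K → ∀ c ∈ Bad' K t, F K c * Rf K c ≤ famWeight (bslotPrice (y K)) (str K c))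
    (hF' : ∀ K t, |t| ≤ l₀ → K₀ ≤ K → ∀ c ∈ Bad' K t, F' K c * Rf' K c ≤ famWeight (bslotPrice (y K)) (str K c)) :
    ∃ K₁, K₀ ≤ K₁ ∧ RelWeightBound l₀ T A A' (fun K t => if K₁ ≤ K then badOfClass π T Bad' K t else ∅)
      (Set.indicator {K | K₁ ≤ K}
        (fun K => Cn * recordsBudget (Δ * birthMass C) C.κ₁ V Λ ηplus jstar K)) :=
  exists_relWeightBound_of_rawFactorLE sh h.valid.κ₁_nonneg R g
    (fun K hK => rawFactorLE_of_irThreshold sh h K (R K) (g K) (β' K) (h27 K hK) (h29 K hK) (hR K hK) (hx1 K hK)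
      (hir K hK))
    Cell hV hΛ hcell (fun _ => menuRen) (fun _ => menuMer) (dictB Dcap) (dictB Dcap) Ncap (fun _ t => menuMer_step t)
    (fun K j => sum_dictB_rho_le hμ₀ Dcap K j (hP K j)) (fun _ t => (sum_menuRen_eta C t).le)
    (fun _ t => (sum_menuMer_eta C t).le) (fun K s => sum_dictB_eta_le hμ₀ Dcap K s) hηplus hr hΛ0 h1 hx jstar hj hc
    hfrac hΔ y hy0 hlabTLE str hinj hstr hA hA' hF hF' hCn

end Exit

end

end Summit.QuantumFields.BalabanUV.T4Continuum.HistoryExitLE
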